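import Mathlib
import HarnessLib
import Summits.Ventures.LatticeQCDFlow.Exactness.SU2WilsonFlowLOSchedule

/-!
# The engine's parity-masked LO Wilson-flow member is TRANSLATION EQUIVARIANT under every lattice translation that preserves the mask (even translations), with a translation-invariant running log-det; the Wilson action is translation invariant

HONEST FRAMING: exact (Metropolis-corrected) sampling algorithms for lattice gauge theory;
figures of merit are autocorrelation/cost numbers at stated couplings and volumes; no
continuum-physics claim.

Venture `LatticeQCDFlow` (cell pub-lqcd), topic `Exactness`; FANOUT row 14 (`eng-flowhmc`, engine
`latflow.fthmc` on the periodic torus `Site d L = (Fin d → ZMod L)`; member `maps.wilson_flow_lo`: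
masked Euler sub-steps of the `SU(2)` Wilson flow, masks = site colourings `χ`).  NEW WORK of the
cell; nothing is cited as a fact; no number.  `SU2FTHMCTranslationCovariance.su2_fthmc_conjKernel_translate`
(GEN-10) proves that the FT-HMC kernel commutes with a lattice translation `(V·t)(x, μ) = V(x + t, μ)`
GIVEN a translation-equivariant member `F (V·t) = (F V)·t` with translation-invariant booked density;
its NOT-CLAIMED list says that the engine's parity-masked members are equivariant under EVEN
translations only and that this was not typed.  This file types it, for every colouring and every
translation `t` preserving the colouring (`χ (x + t) = χ x`; for the parity mask: `Σ tᵢ` even):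

* schedules of layers under ANY symmetry `Θ` of the data (any measurable space): `foldr_trans_comm`
  (the composite `F_n ∘ ⋯ ∘ F_1` commutes with `Θ` when every layer does), `foldr_logDet_invariant`
  (the running log-det `J_1(v) J_2(F_1 v) ⋯` is `Θ`-invariant when moreover every booked density
  is), `comm_of_layers_map_eq` (transfer through the `exists_layers_*` packaging
  `layers.map … = sched.map …`);
* any group: `plaquetteHolonomy_translate` (`U_p(V·t)(x) = U_p(V)(x + t)`),
  **`wilsonAction_comp_translate`** (`S_W(V·t) = S_W(V)` for every representation `ρ` — re-index
  the plaquette sum), so `β·S_W` meets the action hypothesis of `su2_fthmc_conjKernel_translate`;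
* the `SU(2)` LO member VERBATIM (formulas of `exists_layers_su2WilsonFlowLO`):
  `stapleJ_translate` (the conjugate-staple field translates: `J_e(V·t) = J_(e+t)(V)`),
  **`su2WilsonFlowLOSubstep_translate`** (the masked sub-step `(μ, b)` is translation equivariant
  whenever `χ (x + t) = χ x` for all `x`), **`su2WilsonFlowLOJacobian_translate`** (its booked density
  `∏_active j̃` is translation invariant — re-index the active class, which `t` preserves),
  **`su2WilsonFlowLO_member_translate`** (for ANY schedule and ANY `layers` packaged as in
  `exists_layers_su2WilsonFlowLO`: the composite is translation equivariant and the running log-det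
  translation invariant — exactly the hypotheses `hF`, `hJ` of `su2_fthmc_conjKernel_translate` /
  `su2_fthmc_exactForce_conjKernel_translate`).

NOT CLAIMED: translations that permute the colour classes (a one-class sub-step is then carried to
ANOTHER sub-step of the sweep; the sequential sweep is not equivariant under odd translations in
general); rotations / reflections; the learned residual members (their weights must be translation
covariant — a CNN conditioner — not typed here); any number.
-/

noncomputable section

namespace Summit.Ventures.LatticeQCDFlow.Exactness

open Real Set MeasureTheory InnerProductGeometry WithLp
open Literature.MathematicalPhysics.QuantumFieldTheory

/-! ## Schedules of layers under a symmetry of the data -/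

section Package

variable {Ω : Type*} [MeasurableSpace Ω]

/-- **A member composed of `Θ`-equivariant layers is `Θ`-equivariant**: if every layer map commutes
with `Θ`, so does the composite `F_n ∘ ⋯ ∘ F_1` (the `foldr … trans` packaging of
`hasJacobian_foldr_trans`). -/
theorem foldr_trans_comm (Θ : Ω → Ω) (layers : List ((Ω ≃ᵐ Ω) × (Ω → ℝ)))
    (hF : ∀ Ly ∈ layers, ∀ v, Ly.1 (Θ v) = Θ (Ly.1 v)) (v : Ω) :
    (layers.foldr (fun Ly (G : Ω ≃ᵐ Ω) => Ly.1.trans G) (MeasurableEquiv.refl Ω)) (Θ v) =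
      Θ ((layers.foldr (fun Ly (G : Ω ≃ᵐ Ω) => Ly.1.trans G) (MeasurableEquiv.refl Ω)) v) := by
  induction layers generalizing v with
  | nil => rfl
  | cons Ly rest ih =>
    rw [List.foldr_cons, MeasurableEquiv.coe_trans, Function.comp_apply, Function.comp_apply,
      hF Ly List.mem_cons_self v]
    exact ih (fun L hL => hF L (List.mem_cons_of_mem _ hL)) _

/-- **The running log-det of such a member is `Θ`-invariant**: the accumulated density
`v ↦ J_1(v) · J_2(F_1 v) ⋯` (the `foldr` of `hasJacobian_foldr_trans`) is invariant under `Θ` when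
every layer map commutes with `Θ` and every booked density is `Θ`-invariant. -/
theorem foldr_logDet_invariant (Θ : Ω → Ω) (layers : List ((Ω ≃ᵐ Ω) × (Ω → ℝ)))
    (hF : ∀ Ly ∈ layers, ∀ v, Ly.1 (Θ v) = Θ (Ly.1 v)) (hJ : ∀ Ly ∈ layers, ∀ v, Ly.2 (Θ v) = Ly.2 v)
    (v : Ω) :
    (layers.foldr (fun Ly K => fun v => Ly.2 v * K (Ly.1 v)) (fun _ => (1 : ℝ))) (Θ v) =
      (layers.foldr (fun Ly K => fun v => Ly.2 v * K (Ly.1 v)) (fun _ => (1 : ℝ))) v := by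
  induction layers generalizing v with
  | nil => rfl
  | cons Ly rest ih =>
    simp only [List.foldr_cons]
    rw [hJ Ly List.mem_cons_self v, hF Ly List.mem_cons_self v,
      ih (fun L hL => hF L (List.mem_cons_of_mem _ hL)) (fun L hL => hJ L (List.mem_cons_of_mem _ hL)) (Ly.1 v)]

/-- **Transfer through the `exists_layers_*` packaging.**  If the layers' forward maps and densities
ARE, position by position, maps `Fm s` and densities `Jm s` indexed by a schedule
(`layers.map … = sched.map …`) and each `Fm s` commutes with `Θ` with `Jm s` `Θ`-invariant, then
every layer commutes with `Θ` with a `Θ`-invariant density. -/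
theorem comm_of_layers_map_eq {σ : Type*} (Θ : Ω → Ω) (layers : List ((Ω ≃ᵐ Ω) × (Ω → ℝ)))
    (sched : List σ) (Fm : σ → Ω → Ω) (Jm : σ → Ω → ℝ)
    (hmap : layers.map (fun Ly => ((Ly.1 : Ω → Ω), Ly.2)) = sched.map (fun s => (Fm s, Jm s)))
    (hF : ∀ s ∈ sched, ∀ v, Fm s (Θ v) = Θ (Fm s v)) (hJ : ∀ s ∈ sched, ∀ v, Jm s (Θ v) = Jm s v) :
    (∀ Ly ∈ layers, ∀ v, Ly.1 (Θ v) = Θ (Ly.1 v)) ∧ (∀ Ly ∈ layers, ∀ v, Ly.2 (Θ v) = Ly.2 v) := by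
  have key : ∀ Ly ∈ layers, ∃ s ∈ sched, (Fm s, Jm s) = ((Ly.1 : Ω → Ω), Ly.2) := by
    intro Ly hLy
    have hmem : ((Ly.1 : Ω → Ω), Ly.2) ∈ sched.map (fun s => (Fm s, Jm s)) := by
      rw [← hmap]
      exact List.mem_map.mpr ⟨Ly, hLy, rfl⟩
    exact List.mem_map.mp hmem
  refine ⟨fun Ly hLy v => ?_, fun Ly hLy v => ?_⟩
  · obtain ⟨s, hs, hEq⟩ := key Ly hLy
    have h1 : Fm s = (Ly.1 : Ω → Ω) := (Prod.mk.inj hEq).1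
    have h2 := hF s hs v
    rw [h1] at h2
    exact h2
  · obtain ⟨s, hs, hEq⟩ := key Ly hLy
    have h1 : Jm s = Ly.2 := (Prod.mk.inj hEq).2
    have h2 := hJ s hs v
    rw [h1] at h2
    exact h2

end Package

/-! ## Lattice translations (any group): plaquettes and the Wilson action -/

section Lattice

variable {d L : ℕ} {G : Type*} [Group G]

/-- **Plaquette holonomies translate**: `U_p(V·t)` at `x` is `U_p(V)` at `x + t`. -/
theorem plaquetteHolonomy_translate (t : Site d L) (V : GaugeConfig d L G) (x : Site d L) (i j : Fin d) :
    plaquetteHolonomy (fun e : Edge d L => V (e.1 + t, e.2)) x i j = plaquetteHolonomy V (x + t) i j := by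
  have hs : ∀ (y : Site d L) (k : Fin d), Site.shift y k + t = Site.shift (y + t) k := fun y k => by
    simp only [Site.shift]
    abel
  simp only [plaquetteHolonomy, hs]

/-- **The Wilson action is translation invariant**: `S_W(V·t) = S_W(V)` for every matrix
representation `ρ` and every translation `t` (re-index the sum over plaquettes by `x ↦ x + t`). -/
theorem wilsonAction_comp_translate {N : ℕ} [NeZero L] (ρ : G →* Matrix (Fin N) (Fin N) ℂ) (t : Site d L)
    (V : GaugeConfig d L G) :
    wilsonAction ρ (fun e : Edge d L => V (e.1 + t, e.2)) = wilsonAction ρ V := by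
  unfold wilsonAction
  simp only [plaquetteHolonomy_translate]
  exact Fintype.sum_equiv (Equiv.prodCongr (Equiv.addRight t) (Equiv.refl _)) _ _ (fun p => rfl)

end Lattice

/-! ## The `SU(2)` LO member -/

section SU2

variable {d L : ℕ} {X : Type*} [DecidableEq X] (χ : Site d L → X)

omit [DecidableEq X] in
/-- **The conjugate-staple field translates**: `J_e(V·t) = J_(e + t)(V)` (`e + t = (x + t, μ)` for
`e = (x, μ)`). -/
theorem stapleJ_translate (t : Site d L) (V : GaugeConfig d L (Matrix.specialUnitaryGroup (Fin 2) ℂ)) (e : Edge d L) :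
    (∑ ν ∈ Finset.univ.erase e.2,
            (vecQuat ((((fun e : Edge d L => V (e.1 + t, e.2)) (Site.shift e.1 e.2, ν) * ((fun e : Edge d L => V (e.1 + t, e.2)) (Site.shift e.1 ν, e.2))⁻¹ * ((fun e : Edge d L => V (e.1 + t, e.2)) (e.1, ν))⁻¹)⁻¹ : (Matrix.specialUnitaryGroup (Fin 2) ℂ)) : Matrix (Fin 2) (Fin 2) ℂ) +
              vecQuat (((((fun e : Edge d L => V (e.1 + t, e.2)) (Site.shift (e.1 - Pi.single ν 1) e.2, ν))⁻¹ * ((fun e : Edge d L => V (e.1 + t, e.2)) (e.1 - Pi.single ν 1, e.2))⁻¹ *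
                (fun e : Edge d L => V (e.1 + t, e.2)) (e.1 - Pi.single ν 1, ν))⁻¹ : (Matrix.specialUnitaryGroup (Fin 2) ℂ)) : Matrix (Fin 2) (Fin 2) ℂ))) =
      (∑ ν ∈ Finset.univ.erase e.2,
            (vecQuat (((V (Site.shift (e.1 + t) e.2, ν) * (V (Site.shift (e.1 + t) ν, e.2))⁻¹ * (V ((e.1 + t), ν))⁻¹)⁻¹ : (Matrix.specialUnitaryGroup (Fin 2) ℂ)) : Matrix (Fin 2) (Fin 2) ℂ) +
              vecQuat ((((V (Site.shift ((e.1 + t) - Pi.single ν 1) e.2, ν))⁻¹ * (V ((e.1 + t) - Pi.single ν 1, e.2))⁻¹ *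
                V ((e.1 + t) - Pi.single ν 1, ν))⁻¹ : (Matrix.specialUnitaryGroup (Fin 2) ℂ)) : Matrix (Fin 2) (Fin 2) ℂ))) := by
  have hs : ∀ (y : Site d L) (k : Fin d), Site.shift y k + t = Site.shift (y + t) k := fun y k => by
    simp only [Site.shift]
    abel
  have hsub : ∀ (y : Site d L) (ν : Fin d), y - Pi.single ν 1 + t = y + t - Pi.single ν 1 :=
    fun y ν => sub_add_eq_add_sub y (Pi.single ν 1) t
  simp only [hs, hsub]

/-- **The masked `SU(2)` Wilson-flow sub-step is translation equivariant** under every translation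
`t` preserving the colouring (`χ (x + t) = χ x`): `F(V·t) = (F V)·t` (formulas VERBATIM as in
`exists_layers_su2WilsonFlowLO`, direction `μ`, class `b`, any `ε`). -/
theorem su2WilsonFlowLOSubstep_translate (t : Site d L) (hχ : ∀ x : Site d L, χ (x + t) = χ x)
    (μ : Fin d) (b : X) (ε : ℝ) (V : GaugeConfig d L (Matrix.specialUnitaryGroup (Fin 2) ℂ)) :
    (fun (V : GaugeConfig d L (Matrix.specialUnitaryGroup (Fin 2) ℂ)) (e : Edge d L) =>
        if e.2 = μ ∧ χ e.1 = b then
          gaussUnit (geodesicKick ε (∑ ν ∈ Finset.univ.erase e.2,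
            (vecQuat (((V (Site.shift e.1 e.2, ν) * (V (Site.shift e.1 ν, e.2))⁻¹ * (V (e.1, ν))⁻¹)⁻¹ : (Matrix.specialUnitaryGroup (Fin 2) ℂ)) : Matrix (Fin 2) (Fin 2) ℂ) +
              vecQuat ((((V (Site.shift (e.1 - Pi.single ν 1) e.2, ν))⁻¹ * (V (e.1 - Pi.single ν 1, e.2))⁻¹ *
                V (e.1 - Pi.single ν 1, ν))⁻¹ : (Matrix.specialUnitaryGroup (Fin 2) ℂ)) : Matrix (Fin 2) (Fin 2) ℂ)))
            (vecQuat ((V e : (Matrix.specialUnitaryGroup (Fin 2) ℂ)) : Matrix (Fin 2) (Fin 2) ℂ)))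
        else V e) (fun e : Edge d L => V (e.1 + t, e.2)) =
      fun e : Edge d L => ((fun (V : GaugeConfig d L (Matrix.specialUnitaryGroup (Fin 2) ℂ)) (e : Edge d L) =>
        if e.2 = μ ∧ χ e.1 = b then
          gaussUnit (geodesicKick ε (∑ ν ∈ Finset.univ.erase e.2,
            (vecQuat (((V (Site.shift e.1 e.2, ν) * (V (Site.shift e.1 ν, e.2))⁻¹ * (V (e.1, ν))⁻¹)⁻¹ : (Matrix.specialUnitaryGroup (Fin 2) ℂ)) : Matrix (Fin 2) (Fin 2) ℂ) +
              vecQuat ((((V (Site.shift (e.1 - Pi.single ν 1) e.2, ν))⁻¹ * (V (e.1 - Pi.single ν 1, e.2))⁻¹ *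
                V (e.1 - Pi.single ν 1, ν))⁻¹ : (Matrix.specialUnitaryGroup (Fin 2) ℂ)) : Matrix (Fin 2) (Fin 2) ℂ)))
            (vecQuat ((V e : (Matrix.specialUnitaryGroup (Fin 2) ℂ)) : Matrix (Fin 2) (Fin 2) ℂ)))
        else V e) V) (e.1 + t, e.2) := by
  have hs : ∀ (y : Site d L) (k : Fin d), Site.shift y k + t = Site.shift (y + t) k := fun y k => by
    simp only [Site.shift]
    abel
  have hsub : ∀ (y : Site d L) (ν : Fin d), y - Pi.single ν 1 + t = y + t - Pi.single ν 1 :=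
    fun y ν => sub_add_eq_add_sub y (Pi.single ν 1) t
  funext e
  simp only [hs, hsub, hχ]

variable [NeZero L]

/-- **The booked density of the masked sub-step is translation invariant** under every translation
preserving the colouring: `J(V·t) = J(V)` (re-index the active class `{e | e.2 = μ ∧ χ e.1 = b}`,
which `t` maps to itself). -/
theorem su2WilsonFlowLOJacobian_translate (t : Site d L) (hχ : ∀ x : Site d L, χ (x + t) = χ x)
    (μ : Fin d) (b : X) (ε : ℝ) (V : GaugeConfig d L (Matrix.specialUnitaryGroup (Fin 2) ℂ)) :
    (fun V : GaugeConfig d L (Matrix.specialUnitaryGroup (Fin 2) ℂ) => ∏ a : {e : Edge d L // e.2 = μ ∧ χ e.1 = b},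
          (if Real.sin (angle (∑ ν ∈ Finset.univ.erase a.1.2,
            (vecQuat (((V (Site.shift a.1.1 a.1.2, ν) * (V (Site.shift a.1.1 ν, a.1.2))⁻¹ * (V (a.1.1, ν))⁻¹)⁻¹ : (Matrix.specialUnitaryGroup (Fin 2) ℂ)) : Matrix (Fin 2) (Fin 2) ℂ) +
              vecQuat ((((V (Site.shift (a.1.1 - Pi.single ν 1) a.1.2, ν))⁻¹ * (V (a.1.1 - Pi.single ν 1, a.1.2))⁻¹ *
                V (a.1.1 - Pi.single ν 1, ν))⁻¹ : (Matrix.specialUnitaryGroup (Fin 2) ℂ)) : Matrix (Fin 2) (Fin 2) ℂ))) (vecQuat ((V a.1 : (Matrix.specialUnitaryGroup (Fin 2) ℂ)) : Matrix (Fin 2) (Fin 2) ℂ))) = 0 then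
            (1 - ε * ‖(∑ ν ∈ Finset.univ.erase a.1.2,
            (vecQuat (((V (Site.shift a.1.1 a.1.2, ν) * (V (Site.shift a.1.1 ν, a.1.2))⁻¹ * (V (a.1.1, ν))⁻¹)⁻¹ : (Matrix.specialUnitaryGroup (Fin 2) ℂ)) : Matrix (Fin 2) (Fin 2) ℂ) +
              vecQuat ((((V (Site.shift (a.1.1 - Pi.single ν 1) a.1.2, ν))⁻¹ * (V (a.1.1 - Pi.single ν 1, a.1.2))⁻¹ *
                V (a.1.1 - Pi.single ν 1, ν))⁻¹ : (Matrix.specialUnitaryGroup (Fin 2) ℂ)) : Matrix (Fin 2) (Fin 2) ℂ)))‖ * Real.cos (angle (∑ ν ∈ Finset.univ.erase a.1.2,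
            (vecQuat (((V (Site.shift a.1.1 a.1.2, ν) * (V (Site.shift a.1.1 ν, a.1.2))⁻¹ * (V (a.1.1, ν))⁻¹)⁻¹ : (Matrix.specialUnitaryGroup (Fin 2) ℂ)) : Matrix (Fin 2) (Fin 2) ℂ) +
              vecQuat ((((V (Site.shift (a.1.1 - Pi.single ν 1) a.1.2, ν))⁻¹ * (V (a.1.1 - Pi.single ν 1, a.1.2))⁻¹ *
                V (a.1.1 - Pi.single ν 1, ν))⁻¹ : (Matrix.specialUnitaryGroup (Fin 2) ℂ)) : Matrix (Fin 2) (Fin 2) ℂ))) (vecQuat ((V a.1 : (Matrix.specialUnitaryGroup (Fin 2) ℂ)) : Matrix (Fin 2) (Fin 2) ℂ)))) ^ 3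
          else kickJac (ε * ‖(∑ ν ∈ Finset.univ.erase a.1.2,
            (vecQuat (((V (Site.shift a.1.1 a.1.2, ν) * (V (Site.shift a.1.1 ν, a.1.2))⁻¹ * (V (a.1.1, ν))⁻¹)⁻¹ : (Matrix.specialUnitaryGroup (Fin 2) ℂ)) : Matrix (Fin 2) (Fin 2) ℂ) +
              vecQuat ((((V (Site.shift (a.1.1 - Pi.single ν 1) a.1.2, ν))⁻¹ * (V (a.1.1 - Pi.single ν 1, a.1.2))⁻¹ *
                V (a.1.1 - Pi.single ν 1, ν))⁻¹ : (Matrix.specialUnitaryGroup (Fin 2) ℂ)) : Matrix (Fin 2) (Fin 2) ℂ)))‖) 2 (angle (∑ ν ∈ Finset.univ.erase a.1.2,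
            (vecQuat (((V (Site.shift a.1.1 a.1.2, ν) * (V (Site.shift a.1.1 ν, a.1.2))⁻¹ * (V (a.1.1, ν))⁻¹)⁻¹ : (Matrix.specialUnitaryGroup (Fin 2) ℂ)) : Matrix (Fin 2) (Fin 2) ℂ) +
              vecQuat ((((V (Site.shift (a.1.1 - Pi.single ν 1) a.1.2, ν))⁻¹ * (V (a.1.1 - Pi.single ν 1, a.1.2))⁻¹ *
                V (a.1.1 - Pi.single ν 1, ν))⁻¹ : (Matrix.specialUnitaryGroup (Fin 2) ℂ)) : Matrix (Fin 2) (Fin 2) ℂ))) (vecQuat ((V a.1 : (Matrix.specialUnitaryGroup (Fin 2) ℂ)) : Matrix (Fin 2) (Fin 2) ℂ))))) (fun e : Edge d L => V (e.1 + t, e.2)) =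
      (fun V : GaugeConfig d L (Matrix.specialUnitaryGroup (Fin 2) ℂ) => ∏ a : {e : Edge d L // e.2 = μ ∧ χ e.1 = b},
          (if Real.sin (angle (∑ ν ∈ Finset.univ.erase a.1.2,
            (vecQuat (((V (Site.shift a.1.1 a.1.2, ν) * (V (Site.shift a.1.1 ν, a.1.2))⁻¹ * (V (a.1.1, ν))⁻¹)⁻¹ : (Matrix.specialUnitaryGroup (Fin 2) ℂ)) : Matrix (Fin 2) (Fin 2) ℂ) +
              vecQuat ((((V (Site.shift (a.1.1 - Pi.single ν 1) a.1.2, ν))⁻¹ * (V (a.1.1 - Pi.single ν 1, a.1.2))⁻¹ *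
                V (a.1.1 - Pi.single ν 1, ν))⁻¹ : (Matrix.specialUnitaryGroup (Fin 2) ℂ)) : Matrix (Fin 2) (Fin 2) ℂ))) (vecQuat ((V a.1 : (Matrix.specialUnitaryGroup (Fin 2) ℂ)) : Matrix (Fin 2) (Fin 2) ℂ))) = 0 then
            (1 - ε * ‖(∑ ν ∈ Finset.univ.erase a.1.2,
            (vecQuat (((V (Site.shift a.1.1 a.1.2, ν) * (V (Site.shift a.1.1 ν, a.1.2))⁻¹ * (V (a.1.1, ν))⁻¹)⁻¹ : (Matrix.specialUnitaryGroup (Fin 2) ℂ)) : Matrix (Fin 2) (Fin 2) ℂ) +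
              vecQuat ((((V (Site.shift (a.1.1 - Pi.single ν 1) a.1.2, ν))⁻¹ * (V (a.1.1 - Pi.single ν 1, a.1.2))⁻¹ *
                V (a.1.1 - Pi.single ν 1, ν))⁻¹ : (Matrix.specialUnitaryGroup (Fin 2) ℂ)) : Matrix (Fin 2) (Fin 2) ℂ)))‖ * Real.cos (angle (∑ ν ∈ Finset.univ.erase a.1.2,
            (vecQuat (((V (Site.shift a.1.1 a.1.2, ν) * (V (Site.shift a.1.1 ν, a.1.2))⁻¹ * (V (a.1.1, ν))⁻¹)⁻¹ : (Matrix.specialUnitaryGroup (Fin 2) ℂ)) : Matrix (Fin 2) (Fin 2) ℂ) +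
              vecQuat ((((V (Site.shift (a.1.1 - Pi.single ν 1) a.1.2, ν))⁻¹ * (V (a.1.1 - Pi.single ν 1, a.1.2))⁻¹ *
                V (a.1.1 - Pi.single ν 1, ν))⁻¹ : (Matrix.specialUnitaryGroup (Fin 2) ℂ)) : Matrix (Fin 2) (Fin 2) ℂ))) (vecQuat ((V a.1 : (Matrix.specialUnitaryGroup (Fin 2) ℂ)) : Matrix (Fin 2) (Fin 2) ℂ)))) ^ 3
          else kickJac (ε * ‖(∑ ν ∈ Finset.univ.erase a.1.2,
            (vecQuat (((V (Site.shift a.1.1 a.1.2, ν) * (V (Site.shift a.1.1 ν, a.1.2))⁻¹ * (V (a.1.1, ν))⁻¹)⁻¹ : (Matrix.specialUnitaryGroup (Fin 2) ℂ)) : Matrix (Fin 2) (Fin 2) ℂ) +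
              vecQuat ((((V (Site.shift (a.1.1 - Pi.single ν 1) a.1.2, ν))⁻¹ * (V (a.1.1 - Pi.single ν 1, a.1.2))⁻¹ *
                V (a.1.1 - Pi.single ν 1, ν))⁻¹ : (Matrix.specialUnitaryGroup (Fin 2) ℂ)) : Matrix (Fin 2) (Fin 2) ℂ)))‖) 2 (angle (∑ ν ∈ Finset.univ.erase a.1.2,
            (vecQuat (((V (Site.shift a.1.1 a.1.2, ν) * (V (Site.shift a.1.1 ν, a.1.2))⁻¹ * (V (a.1.1, ν))⁻¹)⁻¹ : (Matrix.specialUnitaryGroup (Fin 2) ℂ)) : Matrix (Fin 2) (Fin 2) ℂ) +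
              vecQuat ((((V (Site.shift (a.1.1 - Pi.single ν 1) a.1.2, ν))⁻¹ * (V (a.1.1 - Pi.single ν 1, a.1.2))⁻¹ *
                V (a.1.1 - Pi.single ν 1, ν))⁻¹ : (Matrix.specialUnitaryGroup (Fin 2) ℂ)) : Matrix (Fin 2) (Fin 2) ℂ))) (vecQuat ((V a.1 : (Matrix.specialUnitaryGroup (Fin 2) ℂ)) : Matrix (Fin 2) (Fin 2) ℂ))))) V := by
  have hs : ∀ (y : Site d L) (k : Fin d), Site.shift y k + t = Site.shift (y + t) k := fun y k => by
    simp only [Site.shift]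
    abel
  have hsub : ∀ (y : Site d L) (ν : Fin d), y - Pi.single ν 1 + t = y + t - Pi.single ν 1 :=
    fun y ν => sub_add_eq_add_sub y (Pi.single ν 1) t
  -- the translation of the active class onto itself
  have hfwd : ∀ a : {e : Edge d L // e.2 = μ ∧ χ e.1 = b}, (a.1.1 + t, a.1.2).2 = μ ∧ χ (a.1.1 + t, a.1.2).1 = b :=
    fun a => ⟨a.2.1, (hχ a.1.1).trans a.2.2⟩
  have hbwd : ∀ a : {e : Edge d L // e.2 = μ ∧ χ e.1 = b}, (a.1.1 - t, a.1.2).2 = μ ∧ χ (a.1.1 - t, a.1.2).1 = b := by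
    intro a
    refine ⟨a.2.1, ?_⟩
    have h := hχ (a.1.1 - t)
    rw [sub_add_cancel] at h
    exact h ▸ a.2.2
  let τ : {e : Edge d L // e.2 = μ ∧ χ e.1 = b} ≃ {e : Edge d L // e.2 = μ ∧ χ e.1 = b} :=
    { toFun := fun a => ⟨(a.1.1 + t, a.1.2), hfwd a⟩,
      invFun := fun a => ⟨(a.1.1 - t, a.1.2), hbwd a⟩,
      left_inv := fun a => Subtype.ext (Prod.ext (add_sub_cancel_right a.1.1 t) rfl),
      right_inv := fun a => Subtype.ext (Prod.ext (sub_add_cancel a.1.1 t) rfl) }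
  simp only [hs, hsub]
  exact Fintype.prod_equiv τ _ _ (fun a => rfl)

/-- **The LO Wilson-flow member is translation equivariant with a translation-invariant running
log-det** under every translation `t` preserving the colouring.  For ANY list `layers` packaged as
in `exists_layers_su2WilsonFlowLO` (forward maps = the masked sub-steps of the schedule, densities =
their booked Jacobians, formulas VERBATIM) the composite `foldr … trans` map `F` satisfies
`F(V·t) = (F V)·t` and the accumulated density `J` satisfies `J(V·t) = J(V)` — the hypotheses `hF`,
`hJ` of `su2_fthmc_conjKernel_translate`. -/
theorem su2WilsonFlowLO_member_translate (t : Site d L) (hχ : ∀ x : Site d L, χ (x + t) = χ x)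
    (ε : ℝ) (sched : List (Fin d × X))
    (layers : List ((GaugeConfig d L (Matrix.specialUnitaryGroup (Fin 2) ℂ) ≃ᵐ GaugeConfig d L (Matrix.specialUnitaryGroup (Fin 2) ℂ)) × (GaugeConfig d L (Matrix.specialUnitaryGroup (Fin 2) ℂ) → ℝ)))
    (hmap :
      layers.map (fun Ly => ((Ly.1 : GaugeConfig d L (Matrix.specialUnitaryGroup (Fin 2) ℂ) → GaugeConfig d L (Matrix.specialUnitaryGroup (Fin 2) ℂ)), Ly.2)) =
        sched.map (fun s =>
        ((fun (V : GaugeConfig d L (Matrix.specialUnitaryGroup (Fin 2) ℂ)) (e : Edge d L) =>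
        if e.2 = s.1 ∧ χ e.1 = s.2 then
          gaussUnit (geodesicKick ε (∑ ν ∈ Finset.univ.erase e.2,
            (vecQuat (((V (Site.shift e.1 e.2, ν) * (V (Site.shift e.1 ν, e.2))⁻¹ * (V (e.1, ν))⁻¹)⁻¹ : (Matrix.specialUnitaryGroup (Fin 2) ℂ)) : Matrix (Fin 2) (Fin 2) ℂ) +
              vecQuat ((((V (Site.shift (e.1 - Pi.single ν 1) e.2, ν))⁻¹ * (V (e.1 - Pi.single ν 1, e.2))⁻¹ *
                V (e.1 - Pi.single ν 1, ν))⁻¹ : (Matrix.specialUnitaryGroup (Fin 2) ℂ)) : Matrix (Fin 2) (Fin 2) ℂ)))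
            (vecQuat ((V e : (Matrix.specialUnitaryGroup (Fin 2) ℂ)) : Matrix (Fin 2) (Fin 2) ℂ)))
        else V e),
         fun V : GaugeConfig d L (Matrix.specialUnitaryGroup (Fin 2) ℂ) => ∏ a : {e : Edge d L // e.2 = s.1 ∧ χ e.1 = s.2},
          (if Real.sin (angle (∑ ν ∈ Finset.univ.erase a.1.2,
            (vecQuat (((V (Site.shift a.1.1 a.1.2, ν) * (V (Site.shift a.1.1 ν, a.1.2))⁻¹ * (V (a.1.1, ν))⁻¹)⁻¹ : (Matrix.specialUnitaryGroup (Fin 2) ℂ)) : Matrix (Fin 2) (Fin 2) ℂ) +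
              vecQuat ((((V (Site.shift (a.1.1 - Pi.single ν 1) a.1.2, ν))⁻¹ * (V (a.1.1 - Pi.single ν 1, a.1.2))⁻¹ *
                V (a.1.1 - Pi.single ν 1, ν))⁻¹ : (Matrix.specialUnitaryGroup (Fin 2) ℂ)) : Matrix (Fin 2) (Fin 2) ℂ))) (vecQuat ((V a.1 : (Matrix.specialUnitaryGroup (Fin 2) ℂ)) : Matrix (Fin 2) (Fin 2) ℂ))) = 0 then
            (1 - ε * ‖(∑ ν ∈ Finset.univ.erase a.1.2,
            (vecQuat (((V (Site.shift a.1.1 a.1.2, ν) * (V (Site.shift a.1.1 ν, a.1.2))⁻¹ * (V (a.1.1, ν))⁻¹)⁻¹ : (Matrix.specialUnitaryGroup (Fin 2) ℂ)) : Matrix (Fin 2) (Fin 2) ℂ) +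
              vecQuat ((((V (Site.shift (a.1.1 - Pi.single ν 1) a.1.2, ν))⁻¹ * (V (a.1.1 - Pi.single ν 1, a.1.2))⁻¹ *
                V (a.1.1 - Pi.single ν 1, ν))⁻¹ : (Matrix.specialUnitaryGroup (Fin 2) ℂ)) : Matrix (Fin 2) (Fin 2) ℂ)))‖ * Real.cos (angle (∑ ν ∈ Finset.univ.erase a.1.2,
            (vecQuat (((V (Site.shift a.1.1 a.1.2, ν) * (V (Site.shift a.1.1 ν, a.1.2))⁻¹ * (V (a.1.1, ν))⁻¹)⁻¹ : (Matrix.specialUnitaryGroup (Fin 2) ℂ)) : Matrix (Fin 2) (Fin 2) ℂ) +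
              vecQuat ((((V (Site.shift (a.1.1 - Pi.single ν 1) a.1.2, ν))⁻¹ * (V (a.1.1 - Pi.single ν 1, a.1.2))⁻¹ *
                V (a.1.1 - Pi.single ν 1, ν))⁻¹ : (Matrix.specialUnitaryGroup (Fin 2) ℂ)) : Matrix (Fin 2) (Fin 2) ℂ))) (vecQuat ((V a.1 : (Matrix.specialUnitaryGroup (Fin 2) ℂ)) : Matrix (Fin 2) (Fin 2) ℂ)))) ^ 3
          else kickJac (ε * ‖(∑ ν ∈ Finset.univ.erase a.1.2,
            (vecQuat (((V (Site.shift a.1.1 a.1.2, ν) * (V (Site.shift a.1.1 ν, a.1.2))⁻¹ * (V (a.1.1, ν))⁻¹)⁻¹ : (Matrix.specialUnitaryGroup (Fin 2) ℂ)) : Matrix (Fin 2) (Fin 2) ℂ) +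
              vecQuat ((((V (Site.shift (a.1.1 - Pi.single ν 1) a.1.2, ν))⁻¹ * (V (a.1.1 - Pi.single ν 1, a.1.2))⁻¹ *
                V (a.1.1 - Pi.single ν 1, ν))⁻¹ : (Matrix.specialUnitaryGroup (Fin 2) ℂ)) : Matrix (Fin 2) (Fin 2) ℂ)))‖) 2 (angle (∑ ν ∈ Finset.univ.erase a.1.2,
            (vecQuat (((V (Site.shift a.1.1 a.1.2, ν) * (V (Site.shift a.1.1 ν, a.1.2))⁻¹ * (V (a.1.1, ν))⁻¹)⁻¹ : (Matrix.specialUnitaryGroup (Fin 2) ℂ)) : Matrix (Fin 2) (Fin 2) ℂ) +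
              vecQuat ((((V (Site.shift (a.1.1 - Pi.single ν 1) a.1.2, ν))⁻¹ * (V (a.1.1 - Pi.single ν 1, a.1.2))⁻¹ *
                V (a.1.1 - Pi.single ν 1, ν))⁻¹ : (Matrix.specialUnitaryGroup (Fin 2) ℂ)) : Matrix (Fin 2) (Fin 2) ℂ))) (vecQuat ((V a.1 : (Matrix.specialUnitaryGroup (Fin 2) ℂ)) : Matrix (Fin 2) (Fin 2) ℂ))))))) :
    (∀ V : GaugeConfig d L (Matrix.specialUnitaryGroup (Fin 2) ℂ), (layers.foldr (fun Ly (F : GaugeConfig d L (Matrix.specialUnitaryGroup (Fin 2) ℂ) ≃ᵐ GaugeConfig d L (Matrix.specialUnitaryGroup (Fin 2) ℂ)) => Ly.1.trans F)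
        (MeasurableEquiv.refl (GaugeConfig d L (Matrix.specialUnitaryGroup (Fin 2) ℂ)))) (fun e : Edge d L => V (e.1 + t, e.2)) =
        fun e : Edge d L => ((layers.foldr (fun Ly (F : GaugeConfig d L (Matrix.specialUnitaryGroup (Fin 2) ℂ) ≃ᵐ GaugeConfig d L (Matrix.specialUnitaryGroup (Fin 2) ℂ)) => Ly.1.trans F)
        (MeasurableEquiv.refl (GaugeConfig d L (Matrix.specialUnitaryGroup (Fin 2) ℂ)))) V) (e.1 + t, e.2)) ∧
    (∀ V : GaugeConfig d L (Matrix.specialUnitaryGroup (Fin 2) ℂ), (layers.foldr (fun Ly K => fun v => Ly.2 v * K (Ly.1 v)) (fun _ => (1 : ℝ))) (fun e : Edge d L => V (e.1 + t, e.2)) =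
        (layers.foldr (fun Ly K => fun v => Ly.2 v * K (Ly.1 v)) (fun _ => (1 : ℝ))) V) := by
  have key := comm_of_layers_map_eq (fun V : GaugeConfig d L (Matrix.specialUnitaryGroup (Fin 2) ℂ) => (fun e : Edge d L => V (e.1 + t, e.2))) layers sched
    (fun s => (fun (V : GaugeConfig d L (Matrix.specialUnitaryGroup (Fin 2) ℂ)) (e : Edge d L) =>
        if e.2 = s.1 ∧ χ e.1 = s.2 then
          gaussUnit (geodesicKick ε (∑ ν ∈ Finset.univ.erase e.2,
            (vecQuat (((V (Site.shift e.1 e.2, ν) * (V (Site.shift e.1 ν, e.2))⁻¹ * (V (e.1, ν))⁻¹)⁻¹ : (Matrix.specialUnitaryGroup (Fin 2) ℂ)) : Matrix (Fin 2) (Fin 2) ℂ) +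
              vecQuat ((((V (Site.shift (e.1 - Pi.single ν 1) e.2, ν))⁻¹ * (V (e.1 - Pi.single ν 1, e.2))⁻¹ *
                V (e.1 - Pi.single ν 1, ν))⁻¹ : (Matrix.specialUnitaryGroup (Fin 2) ℂ)) : Matrix (Fin 2) (Fin 2) ℂ)))
            (vecQuat ((V e : (Matrix.specialUnitaryGroup (Fin 2) ℂ)) : Matrix (Fin 2) (Fin 2) ℂ)))
        else V e))
    (fun s => fun V : GaugeConfig d L (Matrix.specialUnitaryGroup (Fin 2) ℂ) => ∏ a : {e : Edge d L // e.2 = s.1 ∧ χ e.1 = s.2},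
          (if Real.sin (angle (∑ ν ∈ Finset.univ.erase a.1.2,
            (vecQuat (((V (Site.shift a.1.1 a.1.2, ν) * (V (Site.shift a.1.1 ν, a.1.2))⁻¹ * (V (a.1.1, ν))⁻¹)⁻¹ : (Matrix.specialUnitaryGroup (Fin 2) ℂ)) : Matrix (Fin 2) (Fin 2) ℂ) +
              vecQuat ((((V (Site.shift (a.1.1 - Pi.single ν 1) a.1.2, ν))⁻¹ * (V (a.1.1 - Pi.single ν 1, a.1.2))⁻¹ *
                V (a.1.1 - Pi.single ν 1, ν))⁻¹ : (Matrix.specialUnitaryGroup (Fin 2) ℂ)) : Matrix (Fin 2) (Fin 2) ℂ))) (vecQuat ((V a.1 : (Matrix.specialUnitaryGroup (Fin 2) ℂ)) : Matrix (Fin 2) (Fin 2) ℂ))) = 0 then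
            (1 - ε * ‖(∑ ν ∈ Finset.univ.erase a.1.2,
            (vecQuat (((V (Site.shift a.1.1 a.1.2, ν) * (V (Site.shift a.1.1 ν, a.1.2))⁻¹ * (V (a.1.1, ν))⁻¹)⁻¹ : (Matrix.specialUnitaryGroup (Fin 2) ℂ)) : Matrix (Fin 2) (Fin 2) ℂ) +
              vecQuat ((((V (Site.shift (a.1.1 - Pi.single ν 1) a.1.2, ν))⁻¹ * (V (a.1.1 - Pi.single ν 1, a.1.2))⁻¹ *
                V (a.1.1 - Pi.single ν 1, ν))⁻¹ : (Matrix.specialUnitaryGroup (Fin 2) ℂ)) : Matrix (Fin 2) (Fin 2) ℂ)))‖ * Real.cos (angle (∑ ν ∈ Finset.univ.erase a.1.2,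
            (vecQuat (((V (Site.shift a.1.1 a.1.2, ν) * (V (Site.shift a.1.1 ν, a.1.2))⁻¹ * (V (a.1.1, ν))⁻¹)⁻¹ : (Matrix.specialUnitaryGroup (Fin 2) ℂ)) : Matrix (Fin 2) (Fin 2) ℂ) +
              vecQuat ((((V (Site.shift (a.1.1 - Pi.single ν 1) a.1.2, ν))⁻¹ * (V (a.1.1 - Pi.single ν 1, a.1.2))⁻¹ *
                V (a.1.1 - Pi.single ν 1, ν))⁻¹ : (Matrix.specialUnitaryGroup (Fin 2) ℂ)) : Matrix (Fin 2) (Fin 2) ℂ))) (vecQuat ((V a.1 : (Matrix.specialUnitaryGroup (Fin 2) ℂ)) : Matrix (Fin 2) (Fin 2) ℂ)))) ^ 3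
          else kickJac (ε * ‖(∑ ν ∈ Finset.univ.erase a.1.2,
            (vecQuat (((V (Site.shift a.1.1 a.1.2, ν) * (V (Site.shift a.1.1 ν, a.1.2))⁻¹ * (V (a.1.1, ν))⁻¹)⁻¹ : (Matrix.specialUnitaryGroup (Fin 2) ℂ)) : Matrix (Fin 2) (Fin 2) ℂ) +
              vecQuat ((((V (Site.shift (a.1.1 - Pi.single ν 1) a.1.2, ν))⁻¹ * (V (a.1.1 - Pi.single ν 1, a.1.2))⁻¹ *
                V (a.1.1 - Pi.single ν 1, ν))⁻¹ : (Matrix.specialUnitaryGroup (Fin 2) ℂ)) : Matrix (Fin 2) (Fin 2) ℂ)))‖) 2 (angle (∑ ν ∈ Finset.univ.erase a.1.2,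
            (vecQuat (((V (Site.shift a.1.1 a.1.2, ν) * (V (Site.shift a.1.1 ν, a.1.2))⁻¹ * (V (a.1.1, ν))⁻¹)⁻¹ : (Matrix.specialUnitaryGroup (Fin 2) ℂ)) : Matrix (Fin 2) (Fin 2) ℂ) +
              vecQuat ((((V (Site.shift (a.1.1 - Pi.single ν 1) a.1.2, ν))⁻¹ * (V (a.1.1 - Pi.single ν 1, a.1.2))⁻¹ *
                V (a.1.1 - Pi.single ν 1, ν))⁻¹ : (Matrix.specialUnitaryGroup (Fin 2) ℂ)) : Matrix (Fin 2) (Fin 2) ℂ))) (vecQuat ((V a.1 : (Matrix.specialUnitaryGroup (Fin 2) ℂ)) : Matrix (Fin 2) (Fin 2) ℂ)))))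
    (by beta_reduce; exact hmap)
    (fun s _ V => by beta_reduce; exact su2WilsonFlowLOSubstep_translate χ t hχ s.1 s.2 ε V)
    (fun s _ V => by beta_reduce; exact su2WilsonFlowLOJacobian_translate χ t hχ s.1 s.2 ε V)
  exact ⟨fun V => foldr_trans_comm _ layers key.1 V, fun V => foldr_logDet_invariant _ layers key.1 key.2 V⟩

end SU2

end Summit.Ventures.LatticeQCDFlow.Exactness
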